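import Mathlib
import HarnessLib

/-!
# Fugacity centring and the Chebyshev window (bounds.tex §13, Lemmas 13.3–13.5, abstract part)

HONEST FRAMING (cell pub-hubbard): ladder R1–R4 with certified numbers; no claim on H/H₀. Bounds for
model classes, no materials claim. This file is model-free (imports Mathlib only): it is the abstract
finite-probability skeleton of the DENOMINATOR side of bounds.tex Theorem 13 in the N-sector form, to be
instantiated with the canonical partition functions `w k = Z_k(0) > 0`, `k = 0, …, n = |Λ_L|`, of the
untwisted torus (part F8b of the kernel device; LEAN FILING REQUEST #211.7).

SETTING. Nonnegative weights `w : ℕ → ℝ` on `{0, …, n}` and a real fugacity parameter `s`. The tilted sum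
`gcSum w n s = Σ_{k ≤ n} e^{sk} w k` (the grand-canonical partition function at fugacity `s`), the tilted
mean `gcMean w n s = (Σ k e^{sk} w k)/gcSum` (the mean particle number) and the tilted variance
`gcVar w n s = (Σ (k - gcMean)² e^{sk} w k)/gcSum` (the particle-number variance).

THEOREMS (0 sorry; all weights `w k > 0` for `k ≤ n` where positivity is needed).
* `gcSum_pos`, `gcMean_nonneg`, `gcMean_le`, `gcVar_nonneg`, `continuous_gcSum`, `continuous_gcMean`.
* `gcMean_le_exp_mul` / `sub_gcMean_le_exp_neg_mul` — the tails `gcMean s ≤ e^{s} (Σ k w k)/w 0` for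
  `s ≤ 0` and `n - gcMean s ≤ e^{-s} (Σ (n-k) w k)/w n` for `0 ≤ s`.
* **`exists_gcMean_eq`** (centring, bounds.tex Lemma 13.3): for `0 < N < n` there is a real `s` with
  `gcMean w n s = N` (intermediate value theorem).
* `hasDerivAt_gcSum`, `hasDerivAt_log_gcSum` (`(log gcSum)' = gcMean`), `hasDerivAt_gcMean`
  (`gcMean' = gcVar`): the variance is the second logarithmic derivative of the tilted sum — the entry point
  of the Cauchy estimate of bounds.tex Lemma 13.4 (not in this file).
* **`exists_window_term_ge`** (Chebyshev window, bounds.tex Lemma 13.5, first half): for `K ≥ 1` there is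
  `N* ≤ n` with `|N* - gcMean s| ≤ K` and `(1 - gcVar s / K²) · gcSum s ≤ (2K + 1) · e^{sN*} w N*` — by
  Chebyshev the window `|k - gcMean| ≤ K` carries tilted mass `≥ (1 - gcVar/K²) gcSum`, it has at most
  `2K + 1` integer points, and its largest term is at least the average.

References: bounds.tex §13 (Lemmas 13.3–13.5); the Chebyshev / maximal-term argument is folklore
(e.g. D. Ruelle, Statistical Mechanics (1969) §3.4, equivalence of ensembles) [Ruelle1969].
-/

noncomputable section

namespace Summit.HubbardSuperconductivity.HubbardLadder.Bounds

open Finset Real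

/-! ### The tilted sum, mean and variance -/

/-- The tilted (grand-canonical) sum `Z(s) = Σ_{k ≤ n} e^{sk} w k`.
[programme definition: bounds.tex §13, Lemma 13.3] -/
def gcSum (w : ℕ → ℝ) (n : ℕ) (s : ℝ) : ℝ := ∑ k ∈ range (n + 1), exp (s * k) * w k

/-- The tilted first moment `Σ_{k ≤ n} k e^{sk} w k`. [programme definition: bounds.tex §13, Lemma 13.3] -/
def gcMoment (w : ℕ → ℝ) (n : ℕ) (s : ℝ) : ℝ := ∑ k ∈ range (n + 1), k * (exp (s * k) * w k)

/-- The tilted mean `m(s) = (Σ k e^{sk} w k) / Z(s)` (mean particle number at fugacity `s`).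
[programme definition: bounds.tex §13, Lemma 13.3] -/
def gcMean (w : ℕ → ℝ) (n : ℕ) (s : ℝ) : ℝ := gcMoment w n s / gcSum w n s

/-- The tilted variance `Var(s) = (Σ (k - m(s))² e^{sk} w k) / Z(s)` (particle-number variance at
fugacity `s`). [programme definition: bounds.tex §13, Lemma 13.4] -/
def gcVar (w : ℕ → ℝ) (n : ℕ) (s : ℝ) : ℝ :=
  (∑ k ∈ range (n + 1), (k - gcMean w n s) ^ 2 * (exp (s * k) * w k)) / gcSum w n s

variable {w : ℕ → ℝ} {n : ℕ}

/-- `Z(s) > 0` for positive weights. [folklore] -/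
theorem gcSum_pos (hw : ∀ k ≤ n, 0 < w k) (s : ℝ) : 0 < gcSum w n s := by
  unfold gcSum
  refine Finset.sum_pos (fun k hk => mul_pos (exp_pos _) (hw k ?_)) ⟨0, by simp⟩
  exact Nat.lt_succ_iff.1 (mem_range.1 hk)

/-- `0 ≤ m(s)`. [folklore] -/
theorem gcMean_nonneg (hw : ∀ k ≤ n, 0 < w k) (s : ℝ) : 0 ≤ gcMean w n s := by
  unfold gcMean gcMoment
  refine div_nonneg (Finset.sum_nonneg fun k hk => ?_) (gcSum_pos hw s).le
  exact mul_nonneg (Nat.cast_nonneg _)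
    (mul_nonneg (exp_nonneg _) (hw k (Nat.lt_succ_iff.1 (mem_range.1 hk))).le)

/-- `m(s) ≤ n`. [folklore] -/
theorem gcMean_le (hw : ∀ k ≤ n, 0 < w k) (s : ℝ) : gcMean w n s ≤ n := by
  unfold gcMean gcMoment
  rw [div_le_iff₀ (gcSum_pos hw s), gcSum, Finset.mul_sum]
  refine Finset.sum_le_sum fun k hk => ?_
  have hk' : ((k : ℕ) : ℝ) ≤ n := by exact_mod_cast Nat.lt_succ_iff.1 (mem_range.1 hk)
  exact mul_le_mul_of_nonneg_right hk'
    (mul_nonneg (exp_nonneg _) (hw k (Nat.lt_succ_iff.1 (mem_range.1 hk))).le)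

/-- `0 ≤ Var(s)`. [folklore] -/
theorem gcVar_nonneg (hw : ∀ k ≤ n, 0 < w k) (s : ℝ) : 0 ≤ gcVar w n s := by
  unfold gcVar
  refine div_nonneg (Finset.sum_nonneg fun k hk => mul_nonneg (sq_nonneg _)
    (mul_nonneg (exp_nonneg _) (hw k (Nat.lt_succ_iff.1 (mem_range.1 hk))).le)) (gcSum_pos hw s).le

/-- `Z` is continuous in `s`. [folklore] -/
theorem continuous_gcSum (w : ℕ → ℝ) (n : ℕ) : Continuous (gcSum w n) := by
  unfold gcSum; fun_prop

/-- The first moment is continuous in `s`. [folklore] -/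
theorem continuous_gcMoment (w : ℕ → ℝ) (n : ℕ) : Continuous (gcMoment w n) := by
  unfold gcMoment; fun_prop

/-- `m` is continuous in `s` (positive weights). [folklore] -/
theorem continuous_gcMean (hw : ∀ k ≤ n, 0 < w k) : Continuous (gcMean w n) := by
  unfold gcMean
  exact (continuous_gcMoment w n).div (continuous_gcSum w n) fun s => (gcSum_pos hw s).ne'

/-! ### Tails of the tilted mean and the centring -/

/-- Lower tail: for `s ≤ 0`, `m(s) ≤ e^{s} · (Σ_{k ≤ n} k w k) / w 0`. [folklore] -/
theorem gcMean_le_exp_mul (hw : ∀ k ≤ n, 0 < w k) {s : ℝ} (hs : s ≤ 0) :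
    gcMean w n s ≤ exp s * ((∑ k ∈ range (n + 1), ((k : ℕ) : ℝ) * w k) / w 0) := by
  have hw0 : 0 < w 0 := hw 0 (Nat.zero_le _)
  have hZ : w 0 ≤ gcSum w n s := by
    unfold gcSum
    have h := Finset.single_le_sum (f := fun k : ℕ => exp (s * k) * w k) (s := range (n + 1))
      (fun k hk => mul_nonneg (exp_nonneg _) (hw k (Nat.lt_succ_iff.1 (mem_range.1 hk))).le)
      (mem_range.2 (Nat.succ_pos n))
    simpa using h
  have hmom : gcMoment w n s ≤ exp s * ∑ k ∈ range (n + 1), ((k : ℕ) : ℝ) * w k := by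
    unfold gcMoment
    rw [Finset.mul_sum]
    refine Finset.sum_le_sum fun k hk => ?_
    have hwk : 0 < w k := hw k (Nat.lt_succ_iff.1 (mem_range.1 hk))
    rcases Nat.eq_zero_or_pos k with rfl | hk1
    · simp
    · have hexp : exp (s * k) ≤ exp s := by
        refine exp_le_exp.2 ?_
        have : (1 : ℝ) ≤ k := by exact_mod_cast hk1
        nlinarith
      calc ((k : ℕ) : ℝ) * (exp (s * k) * w k) = exp (s * k) * (((k : ℕ) : ℝ) * w k) := by ring
        _ ≤ exp s * (((k : ℕ) : ℝ) * w k) := mul_le_mul_of_nonneg_right hexp (by positivity)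
  have hmom0 : 0 ≤ gcMoment w n s := by
    unfold gcMoment
    exact Finset.sum_nonneg fun k hk => mul_nonneg (Nat.cast_nonneg _)
      (mul_nonneg (exp_nonneg _) (hw k (Nat.lt_succ_iff.1 (mem_range.1 hk))).le)
  unfold gcMean
  calc gcMoment w n s / gcSum w n s ≤ gcMoment w n s / w 0 :=
        div_le_div_of_nonneg_left hmom0 hw0 hZ
    _ ≤ (exp s * ∑ k ∈ range (n + 1), ((k : ℕ) : ℝ) * w k) / w 0 := div_le_div_of_nonneg_right hmom hw0.le
    _ = exp s * ((∑ k ∈ range (n + 1), ((k : ℕ) : ℝ) * w k) / w 0) := by ring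

/-- Upper tail: for `0 ≤ s`, `n - m(s) ≤ e^{-s} · (Σ_{k ≤ n} (n - k) w k) / w n`. [folklore] -/
theorem sub_gcMean_le_exp_neg_mul (hw : ∀ k ≤ n, 0 < w k) {s : ℝ} (hs : 0 ≤ s) :
    n - gcMean w n s ≤ exp (-s) * ((∑ k ∈ range (n + 1), ((n : ℝ) - ((k : ℕ) : ℝ)) * w k) / w n) := by
  have hwn : 0 < w n := hw n le_rfl
  have hZpos := gcSum_pos hw s
  have hZ : exp (s * n) * w n ≤ gcSum w n s := by
    unfold gcSum
    exact Finset.single_le_sum (f := fun k : ℕ => exp (s * k) * w k) (s := range (n + 1))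
      (fun k hk => mul_nonneg (exp_nonneg _) (hw k (Nat.lt_succ_iff.1 (mem_range.1 hk))).le)
      (mem_range.2 (Nat.lt_succ_self n))
  -- `n - m(s) = (Σ (n-k) e^{sk} w k) / Z(s)`
  have hsub : (n : ℝ) - gcMean w n s =
      (∑ k ∈ range (n + 1), ((n : ℝ) - ((k : ℕ) : ℝ)) * (exp (s * k) * w k)) / gcSum w n s := by
    unfold gcMean gcMoment
    rw [eq_div_iff hZpos.ne', sub_mul, div_mul_cancel₀ _ hZpos.ne', gcSum, Finset.mul_sum,
      ← Finset.sum_sub_distrib]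
    exact Finset.sum_congr rfl fun k _ => by ring
  have hnum : ∑ k ∈ range (n + 1), ((n : ℝ) - ((k : ℕ) : ℝ)) * (exp (s * k) * w k) ≤
      exp (s * n) * exp (-s) * ∑ k ∈ range (n + 1), ((n : ℝ) - ((k : ℕ) : ℝ)) * w k := by
    rw [Finset.mul_sum]
    refine Finset.sum_le_sum fun k hk => ?_
    have hkn : k ≤ n := Nat.lt_succ_iff.1 (mem_range.1 hk)
    have hwk : 0 < w k := hw k hkn
    rcases Nat.eq_or_lt_of_le hkn with rfl | hlt
    · simp
    · have hexp : exp (s * k) ≤ exp (s * n) * exp (-s) := by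
        rw [← exp_add]
        refine exp_le_exp.2 ?_
        have : ((k : ℕ) : ℝ) + 1 ≤ n := by exact_mod_cast hlt
        nlinarith
      have hnk : (0 : ℝ) ≤ n - k := by
        have : ((k : ℕ) : ℝ) ≤ n := by exact_mod_cast hkn
        linarith
      calc ((n : ℝ) - ((k : ℕ) : ℝ)) * (exp (s * k) * w k) = exp (s * k) * (((n : ℝ) - ((k : ℕ) : ℝ)) * w k) := by ring
        _ ≤ exp (s * n) * exp (-s) * (((n : ℝ) - ((k : ℕ) : ℝ)) * w k) :=
            mul_le_mul_of_nonneg_right hexp (mul_nonneg hnk hwk.le)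
  have hnum0 : 0 ≤ ∑ k ∈ range (n + 1), ((n : ℝ) - k) * w k :=
    Finset.sum_nonneg fun k hk => mul_nonneg
      (by have : ((k : ℕ) : ℝ) ≤ n := by exact_mod_cast Nat.lt_succ_iff.1 (mem_range.1 hk)
          linarith) (hw k (Nat.lt_succ_iff.1 (mem_range.1 hk))).le
  rw [hsub, div_le_iff₀ hZpos]
  calc ∑ k ∈ range (n + 1), ((n : ℝ) - k) * (exp (s * k) * w k)
      ≤ exp (s * n) * exp (-s) * ∑ k ∈ range (n + 1), ((n : ℝ) - ((k : ℕ) : ℝ)) * w k := hnum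
    _ = exp (-s) * ((∑ k ∈ range (n + 1), ((n : ℝ) - ((k : ℕ) : ℝ)) * w k) / w n) * (exp (s * n) * w n) := by
        field_simp
    _ ≤ exp (-s) * ((∑ k ∈ range (n + 1), ((n : ℝ) - ((k : ℕ) : ℝ)) * w k) / w n) * gcSum w n s :=
        mul_le_mul_of_nonneg_left hZ (mul_nonneg (exp_nonneg _) (div_nonneg hnum0 hwn.le))

/-- **Centring (bounds.tex Lemma 13.3).** For positive weights and `0 < N < n` there is a real fugacity
`s` with tilted mean exactly `N`. [programme: bounds.tex §13, Lemma 13.3; intermediate value theorem] -/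
theorem exists_gcMean_eq (hw : ∀ k ≤ n, 0 < w k) {N : ℝ} (hN0 : 0 < N) (hNn : N < n) :
    ∃ s : ℝ, gcMean w n s = N := by
  -- the two tails, then abbreviate their constants
  have ht₁ : ∀ s : ℝ, s ≤ 0 →
      gcMean w n s ≤ exp s * ((∑ k ∈ range (n + 1), ((k : ℕ) : ℝ) * w k) / w 0) :=
    fun s hs => gcMean_le_exp_mul hw hs
  have ht₂ : ∀ s : ℝ, 0 ≤ s →
      n - gcMean w n s ≤ exp (-s) * ((∑ k ∈ range (n + 1), ((n : ℝ) - ((k : ℕ) : ℝ)) * w k) / w n) :=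
    fun s hs => sub_gcMean_le_exp_neg_mul hw hs
  set C₁ := (∑ k ∈ range (n + 1), ((k : ℕ) : ℝ) * w k) / w 0 with hC₁
  set C₂ := (∑ k ∈ range (n + 1), ((n : ℝ) - ((k : ℕ) : ℝ)) * w k) / w n with hC₂
  have hC₁0 : 0 ≤ C₁ := div_nonneg (Finset.sum_nonneg fun k hk => mul_nonneg (Nat.cast_nonneg _)
    (hw k (Nat.lt_succ_iff.1 (mem_range.1 hk))).le) (hw 0 (Nat.zero_le _)).le
  have hC₂0 : 0 ≤ C₂ := div_nonneg (Finset.sum_nonneg fun k hk => mul_nonneg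
      (by have : ((k : ℕ) : ℝ) ≤ n := by exact_mod_cast Nat.lt_succ_iff.1 (mem_range.1 hk)
          linarith) (hw k (Nat.lt_succ_iff.1 (mem_range.1 hk))).le) (hw n le_rfl).le
  obtain ⟨s₁, hs₁0, hs₁⟩ : ∃ s₁ : ℝ, s₁ ≤ 0 ∧ gcMean w n s₁ ≤ N := by
    rcases eq_or_lt_of_le hC₁0 with h0 | hpos
    · exact ⟨0, le_rfl, (ht₁ 0 le_rfl).trans (by rw [← h0]; simp [hN0.le])⟩
    · refine ⟨min 0 (Real.log (N / C₁)), min_le_left _ _, (ht₁ _ (min_le_left _ _)).trans ?_⟩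
      calc exp (min 0 (Real.log (N / C₁))) * C₁ ≤ exp (Real.log (N / C₁)) * C₁ :=
            mul_le_mul_of_nonneg_right (exp_le_exp.2 (min_le_right _ _)) hC₁0
        _ = N := by rw [exp_log (div_pos hN0 hpos)]; field_simp
  obtain ⟨s₂, hs₂0, hs₂⟩ : ∃ s₂ : ℝ, 0 ≤ s₂ ∧ N ≤ gcMean w n s₂ := by
    have hnN : 0 < (n : ℝ) - N := sub_pos.2 hNn
    rcases eq_or_lt_of_le hC₂0 with h0 | hpos
    · refine ⟨0, le_rfl, ?_⟩
      have h := ht₂ 0 le_rfl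
      rw [← h0] at h
      simp at h
      linarith
    · refine ⟨max 0 (Real.log (C₂ / (n - N))), le_max_left _ _, ?_⟩
      have h := ht₂ _ (le_max_left 0 (Real.log (C₂ / (n - N))))
      have hle : exp (-max 0 (Real.log (C₂ / (n - N)))) * C₂ ≤ n - N := by
        calc exp (-max 0 (Real.log (C₂ / (n - N)))) * C₂ ≤ exp (-Real.log (C₂ / (n - N))) * C₂ :=
              mul_le_mul_of_nonneg_right (exp_le_exp.2 (neg_le_neg (le_max_right _ _))) hC₂0
          _ = n - N := by rw [exp_neg, exp_log (div_pos hpos hnN)]; field_simp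
      linarith
  -- intermediate value theorem on `[s₁, s₂]`
  have hle : s₁ ≤ s₂ := hs₁0.trans hs₂0
  have hcont : ContinuousOn (gcMean w n) (Set.Icc s₁ s₂) := (continuous_gcMean hw).continuousOn
  obtain ⟨s, _, hs⟩ := intermediate_value_Icc hle hcont ⟨hs₁, hs₂⟩
  exact ⟨s, hs⟩

/-! ### The variance as the second logarithmic derivative -/

/-- `Z'(s) = Σ k e^{sk} w k`. [folklore] -/
theorem hasDerivAt_gcSum (w : ℕ → ℝ) (n : ℕ) (s : ℝ) : HasDerivAt (gcSum w n) (gcMoment w n s) s := by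
  unfold gcSum gcMoment
  have h : ∀ k ∈ range (n + 1), HasDerivAt (fun s => exp (s * k) * w k) (k * (exp (s * k) * w k)) s := by
    intro k _
    have h1 : HasDerivAt (fun s : ℝ => s * k) ((k : ℕ) : ℝ) s := by
      simpa using (hasDerivAt_id s).mul_const ((k : ℕ) : ℝ)
    exact (h1.exp.mul_const (w k)).congr_deriv (by ring)
  exact HasDerivAt.fun_sum h

/-- `(log Z)'(s) = m(s)` (positive weights). [folklore] -/
theorem hasDerivAt_log_gcSum (hw : ∀ k ≤ n, 0 < w k) (s : ℝ) :
    HasDerivAt (fun s => Real.log (gcSum w n s)) (gcMean w n s) s := by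
  unfold gcMean
  exact (hasDerivAt_gcSum w n s).log (gcSum_pos hw s).ne'

/-- The first moment has derivative `Σ k² e^{sk} w k`. [folklore] -/
theorem hasDerivAt_gcMoment (w : ℕ → ℝ) (n : ℕ) (s : ℝ) :
    HasDerivAt (gcMoment w n) (∑ k ∈ range (n + 1), ((k : ℕ) : ℝ) ^ 2 * (exp (s * k) * w k)) s := by
  unfold gcMoment
  have h : ∀ k ∈ range (n + 1),
      HasDerivAt (fun s => ((k : ℕ) : ℝ) * (exp (s * k) * w k)) (((k : ℕ) : ℝ) ^ 2 * (exp (s * k) * w k)) s := by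
    intro k _
    have h1 : HasDerivAt (fun s : ℝ => s * k) ((k : ℕ) : ℝ) s := by
      simpa using (hasDerivAt_id s).mul_const ((k : ℕ) : ℝ)
    exact ((h1.exp.mul_const (w k)).const_mul ((k : ℕ) : ℝ)).congr_deriv (by ring)
  exact HasDerivAt.fun_sum h

/-- The variance identity `Var(s) = (Σ k² e^{sk} w k)/Z(s) - m(s)²`. [folklore] -/
theorem gcVar_eq (hw : ∀ k ≤ n, 0 < w k) (s : ℝ) :
    gcVar w n s = (∑ k ∈ range (n + 1), ((k : ℕ) : ℝ) ^ 2 * (exp (s * k) * w k)) / gcSum w n s -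
      gcMean w n s ^ 2 := by
  have hZ := (gcSum_pos hw s).ne'
  have hm : gcMean w n s * gcSum w n s = gcMoment w n s := by
    unfold gcMean; exact div_mul_cancel₀ _ hZ
  unfold gcVar
  rw [eq_sub_iff_add_eq, div_add' _ _ _ hZ, div_eq_div_iff hZ hZ]
  have hexp : ∑ k ∈ range (n + 1), (((k : ℕ) : ℝ) - gcMean w n s) ^ 2 * (exp (s * k) * w k) =
      ∑ k ∈ range (n + 1), ((k : ℕ) : ℝ) ^ 2 * (exp (s * k) * w k) -
        2 * gcMean w n s * gcMoment w n s + gcMean w n s ^ 2 * gcSum w n s := by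
    rw [gcMoment, gcSum, Finset.mul_sum, Finset.mul_sum, ← Finset.sum_sub_distrib,
      ← Finset.sum_add_distrib]
    exact Finset.sum_congr rfl fun k _ => by ring
  rw [hexp, ← hm]
  ring

/-- `m'(s) = Var(s)`: the variance is the second logarithmic derivative of the tilted sum (positive
weights). [folklore; entry point of bounds.tex Lemma 13.4] -/
theorem hasDerivAt_gcMean (hw : ∀ k ≤ n, 0 < w k) (s : ℝ) :
    HasDerivAt (gcMean w n) (gcVar w n s) s := by
  have hZ := (gcSum_pos hw s).ne'
  have h := (hasDerivAt_gcMoment w n s).fun_div (hasDerivAt_gcSum w n s) hZ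
  refine (h.congr_deriv ?_ : HasDerivAt (fun s => gcMoment w n s / gcSum w n s) _ s)
  rw [gcVar_eq hw s]
  unfold gcMean
  have key : ∀ A A' Z : ℝ, Z ≠ 0 → (A' * Z - A * A) / Z ^ 2 = A' / Z - (A / Z) ^ 2 := by
    intro A A' Z hZ'
    field_simp
  exact key _ _ _ hZ

/-! ### The Chebyshev window -/

/-- Chebyshev: the tilted mass outside the window `|k - m(s)| ≤ K` is at most `Var(s) Z(s) / K²`.
[folklore; bounds.tex Lemma 13.5] -/
theorem sum_filter_window_compl_le (hw : ∀ k ≤ n, 0 < w k) (s : ℝ) {K : ℝ} (hK : 0 < K) :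
    ∑ k ∈ (range (n + 1)).filter (fun k => ¬ |((k : ℕ) : ℝ) - gcMean w n s| ≤ K), exp (s * k) * w k ≤
      gcVar w n s * gcSum w n s / K ^ 2 := by
  have hZ := gcSum_pos hw s
  have hVZ : gcVar w n s * gcSum w n s =
      ∑ k ∈ range (n + 1), (((k : ℕ) : ℝ) - gcMean w n s) ^ 2 * (exp (s * k) * w k) := by
    unfold gcVar; exact div_mul_cancel₀ _ hZ.ne'
  rw [hVZ, le_div_iff₀ (by positivity), Finset.sum_mul]
  calc ∑ k ∈ (range (n + 1)).filter (fun k => ¬ |((k : ℕ) : ℝ) - gcMean w n s| ≤ K),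
        exp (s * k) * w k * K ^ 2
      ≤ ∑ k ∈ (range (n + 1)).filter (fun k => ¬ |((k : ℕ) : ℝ) - gcMean w n s| ≤ K),
          (((k : ℕ) : ℝ) - gcMean w n s) ^ 2 * (exp (s * k) * w k) := by
        refine Finset.sum_le_sum fun k hk => ?_
        obtain ⟨hkr, hkK⟩ := mem_filter.1 hk
        have hwk : 0 < w k := hw k (Nat.lt_succ_iff.1 (mem_range.1 hkr))
        have hK2 : K ^ 2 ≤ (((k : ℕ) : ℝ) - gcMean w n s) ^ 2 := by
          rw [← sq_abs (((k : ℕ) : ℝ) - _)]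
          exact pow_le_pow_left₀ hK.le (not_le.1 hkK).le 2
        calc exp (s * k) * w k * K ^ 2 ≤ exp (s * k) * w k * (((k : ℕ) : ℝ) - gcMean w n s) ^ 2 :=
              mul_le_mul_of_nonneg_left hK2 (by positivity)
          _ = (((k : ℕ) : ℝ) - gcMean w n s) ^ 2 * (exp (s * k) * w k) := by ring
    _ ≤ ∑ k ∈ range (n + 1), (((k : ℕ) : ℝ) - gcMean w n s) ^ 2 * (exp (s * k) * w k) :=
        Finset.sum_le_sum_of_subset_of_nonneg (filter_subset _ _) fun k hk _ =>
          mul_nonneg (sq_nonneg _) (mul_nonneg (exp_nonneg _)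
            (hw k (Nat.lt_succ_iff.1 (mem_range.1 hk))).le)

/-- The window `{k ≤ n : |k - m| ≤ K}` has at most `2K + 1` points. [folklore] -/
theorem card_range_filter_near_mean_le (n : ℕ) (m : ℝ) {K : ℝ} (hK : 0 ≤ K) :
    (((range (n + 1)).filter (fun k => |((k : ℕ) : ℝ) - m| ≤ K)).card : ℝ) ≤ 2 * K + 1 := by
  set W := (range (n + 1)).filter (fun k => |((k : ℕ) : ℝ) - m| ≤ K) with hW
  rcases W.eq_empty_or_nonempty with h0 | hne
  · rw [h0]; simp; linarith
  · obtain ⟨k₀, hk₀, hmin⟩ := W.exists_min_image (fun k => k) hne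
    have hsub : W ⊆ Finset.Icc k₀ (k₀ + ⌊2 * K⌋₊) := by
      intro k hk
      have hk1 := (mem_filter.1 hk).2
      have hk2 := (mem_filter.1 hk₀).2
      rw [abs_le] at hk1 hk2
      refine mem_Icc.2 ⟨hmin k hk, ?_⟩
      have hreal : ((k : ℕ) : ℝ) ≤ k₀ + 2 * K := by linarith
      have hfl : k - k₀ ≤ ⌊2 * K⌋₊ := by
        refine Nat.le_floor ?_
        have hk0le : k₀ ≤ k := hmin k hk
        push_cast [Nat.cast_sub hk0le]
        linarith
      omega
    calc (W.card : ℝ) ≤ ((Finset.Icc k₀ (k₀ + ⌊2 * K⌋₊)).card : ℝ) := by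
          exact_mod_cast Finset.card_le_card hsub
      _ = ⌊2 * K⌋₊ + 1 := by
          rw [Nat.card_Icc, show k₀ + ⌊2 * K⌋₊ + 1 - k₀ = ⌊2 * K⌋₊ + 1 by omega]; push_cast; ring
      _ ≤ 2 * K + 1 := by linarith [Nat.floor_le (show (0 : ℝ) ≤ 2 * K by linarith)]

/-- **Chebyshev window (bounds.tex Lemma 13.5, first half).** For positive weights, any real `s` and
`K ≥ 1` there is an index `N* ≤ n` in the window `|N* - m(s)| ≤ K` whose tilted weight carries at least
the fraction `(1 - Var(s)/K²)/(2K+1)` of the tilted sum: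
`(1 - gcVar s / K²) · gcSum s ≤ (2K + 1) · e^{sN*} w N*`. [programme: bounds.tex §13, Lemma 13.5] -/
theorem exists_window_term_ge (hw : ∀ k ≤ n, 0 < w k) (s : ℝ) {K : ℝ} (hK : 1 ≤ K) :
    ∃ Nstar : ℕ, Nstar ≤ n ∧ |(Nstar : ℝ) - gcMean w n s| ≤ K ∧
      (1 - gcVar w n s / K ^ 2) * gcSum w n s ≤ (2 * K + 1) * (exp (s * Nstar) * w Nstar) := by
  have hK0 : 0 < K := by linarith
  set m := gcMean w n s with hm
  set W := (range (n + 1)).filter (fun k => |((k : ℕ) : ℝ) - m| ≤ K) with hW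
  -- the window is nonempty: it contains `⌊m⌋₊`
  have hm0 : 0 ≤ m := gcMean_nonneg hw s
  have hmn : m ≤ n := gcMean_le hw s
  have hfl : ⌊m⌋₊ ∈ W := by
    refine mem_filter.2 ⟨mem_range.2 ((Nat.floor_lt hm0).2 (by
      have : (n : ℝ) < (n + 1 : ℕ) := by push_cast; linarith
      exact lt_of_le_of_lt hmn this)), ?_⟩
    rw [abs_le]
    constructor
    · linarith [Nat.lt_floor_add_one m]
    · linarith [Nat.floor_le hm0]
  have hne : W.Nonempty := ⟨_, hfl⟩
  -- the largest term in the window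
  obtain ⟨Nstar, hNW, hmax⟩ := W.exists_max_image (fun k => exp (s * k) * w k) hne
  have hNr := (mem_filter.1 hNW).1
  refine ⟨Nstar, Nat.lt_succ_iff.1 (mem_range.1 hNr), (mem_filter.1 hNW).2, ?_⟩
  -- Chebyshev: mass of the window
  have hsplit : gcSum w n s = ∑ k ∈ W, exp (s * k) * w k +
      ∑ k ∈ (range (n + 1)).filter (fun k => ¬ |((k : ℕ) : ℝ) - m| ≤ K), exp (s * k) * w k := by
    unfold gcSum; rw [hW, Finset.sum_filter_add_sum_filter_not]
  have hout := sum_filter_window_compl_le hw s hK0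
  have hwin : (1 - gcVar w n s / K ^ 2) * gcSum w n s ≤ ∑ k ∈ W, exp (s * k) * w k := by
    have : (1 - gcVar w n s / K ^ 2) * gcSum w n s = gcSum w n s - gcVar w n s * gcSum w n s / K ^ 2 := by
      ring
    rw [this]
    linarith
  -- window sum ≤ card · max ≤ (2K+1) · max
  have hcard := card_range_filter_near_mean_le n m hK0.le
  have hmaxsum : ∑ k ∈ W, exp (s * k) * w k ≤ W.card * (exp (s * Nstar) * w Nstar) := by
    have h := Finset.sum_le_card_nsmul W (fun k => exp (s * k) * w k) _ fun k hk => hmax k hk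
    simpa [nsmul_eq_mul] using h
  have hterm0 : 0 ≤ exp (s * Nstar) * w Nstar :=
    mul_nonneg (exp_nonneg _) (hw Nstar (Nat.lt_succ_iff.1 (mem_range.1 hNr))).le
  calc (1 - gcVar w n s / K ^ 2) * gcSum w n s ≤ ∑ k ∈ W, exp (s * k) * w k := hwin
    _ ≤ W.card * (exp (s * Nstar) * w Nstar) := hmaxsum
    _ ≤ (2 * K + 1) * (exp (s * Nstar) * w Nstar) := mul_le_mul_of_nonneg_right hcard hterm0

end Summit.HubbardSuperconductivity.HubbardLadder.Bounds

end
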